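import Literature.Analysis.FluidPDE.FiniteFourierModeEulerCollinear
import Literature.Analysis.FluidPDE.FiniteFourierModeEulerSIP
import Literature.Analysis.FluidPDE.FiniteFourierModeEulerSkeleton

/-!
# Kishimoto–Yoneda, §4: all vertices are Beltrami vectors once one vertex is

Support file for `FiniteFourierModeEuler` (N. Kishimoto, T. Yoneda, J. Math. Fluid Mech. 24
(2022) 74 = arXiv:2110.08039). At a time at which every mode of the finite-mode Euler solution is
occupied (`t ∈ I ∖ I₀`), we PROVE the propagation half of Propositions 4.4 and 4.7:

* (from `FiniteFourierModeEulerCollinear`) `IsBV.false_of_two_on_ray`, Lemma 4.5 (ii): a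
  Beltrami vector cannot be non-interacting with non-zero divergence-free vectors at two further
  points of a line through its frequency;
* `isBV_of_exposed` (**Props. 4.4 (iii), 4.7, propagation along edges**): if the coefficient vector
  at ONE exposed vertex `n₁` of `S^{conv}` (here: a vertex exposed by `x ↦ n₁·x`, e.g. a farthest
  point) is a Beltrami vector with eigenvalue `μ`, then so is the coefficient vector at EVERY exposed
  vertex, with the same `μ` (Remark 4.3 (iv): "if `u₁` is shown to be `BV⁺` … then `u₂` is also
  `BV⁺`"; the paper moves along adjacent vertices, we move along the edge of `S^{conv}` leaving a
  vertex in the direction of a generic functional maximised at `n₁`,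
  `KY.exists_exposed_edge_up`).

## References

* [KishimotoYoneda2022] N. Kishimoto, T. Yoneda, J. Math. Fluid Mech. 24 (2022) 74 =
  arXiv:2110.08039, §4 Lemma 4.5, Prop. 4.4 (ii),(iii), Remark 4.3 (iv), Prop. 4.7.
-/

noncomputable section

open Matrix Finset

namespace Literature.Analysis.FluidPDE

namespace KY

/-! ### Propagation of the Beltrami property to all exposed vertices -/

/-- The "tie vector" of `s, s'` at the vertex `x` exposed by `φ` is orthogonal to `g` when both
tie in the edge construction. [folklore] -/
theorem tie_vector_eq_zero {φ g x s s' : Fin 3 → ℝ} {lam : ℝ}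
    (hs : (φ + lam • g) ⬝ᵥ s = (φ + lam • g) ⬝ᵥ x)
    (hs' : (φ + lam • g) ⬝ᵥ s' = (φ + lam • g) ⬝ᵥ x) :
    g ⬝ᵥ ((φ ⬝ᵥ x - φ ⬝ᵥ s) • (s' - x) - (φ ⬝ᵥ x - φ ⬝ᵥ s') • (s - x)) = 0 := by
  simp only [add_dotProduct, smul_dotProduct, smul_eq_mul] at hs hs'
  simp only [dotProduct_sub, dotProduct_smul, smul_eq_mul]
  have e1 : φ ⬝ᵥ x - φ ⬝ᵥ s = lam * (g ⬝ᵥ s - g ⬝ᵥ x) := by linarith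
  have e2 : φ ⬝ᵥ x - φ ⬝ᵥ s' = lam * (g ⬝ᵥ s' - g ⬝ᵥ x) := by linarith
  rw [e1, e2]; ring

end KY

namespace KY.IsFiniteModeEulerSolution

open KY

variable {I : Set ℝ} {S : Finset (Fin 3 → ℝ)} {u : (Fin 3 → ℝ) → ℝ → (Fin 3 → ℂ)}

/-- Transport of the Beltrami property along a simply interacting pair. [cite: KishimotoYoneda2022, §4 Remark 4.3 (i),(iv)] -/
theorem isBV_of_sip (hS : IsFiniteModeEulerSolution I S u) {t : ℝ} (ht : t ∈ I)
    (hgen : ∀ n ∈ S, u n t ≠ 0) {μ : ℝ} {a b : Fin 3 → ℝ} (ha : a ∈ S) (hb : b ∈ S) (hab : a ≠ b)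
    (hsum : a + b ∉ S)
    (huniq : ∀ n₃ ∈ S, ∀ n₄ ∈ S, n₃ ≠ n₄ → n₃ + n₄ = a + b → (n₃ = a ∧ n₄ = b) ∨ (n₃ = b ∧ n₄ = a))
    (hk : a ⨯₃ b ≠ 0) (hBV : IsBV μ a (u a t)) : IsBV μ b (u b t) :=
  hBV.transport hk (hgen b hb) (hS.div_free b hb t ht) (hS.nonInteracting_of_sip ha hb hab hsum huniq ht)

/-- **All exposed vertices are Beltrami with the same eigenvalue** (Props. 4.4 (iii) and 4.7,
propagation part, with Lemma 4.5 (ii)). Let every mode of the solution be occupied at time `t`,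
let `n₁ ∈ S` satisfy `n₁ · s < |n₁|²` for `s ∈ S ∖ {n₁}` (e.g. a point of `S` of maximal length)
and let `u_{n₁}(t)` be a Beltrami vector with eigenvalue `μ`. Then at every vertex `v` of `S^{conv}`
exposed by a linear functional, `u_v(t)` is a Beltrami vector with the same eigenvalue `μ`.
[cite: KishimotoYoneda2022, §4 Prop. 4.4 (iii), Prop. 4.7, Remark 4.3 (iv), Lemma 4.5 (ii)] -/
theorem isBV_of_exposed (hS : IsFiniteModeEulerSolution I S u) {t : ℝ} (ht : t ∈ I)
    (hgen : ∀ n ∈ S, u n t ≠ 0) {n₁ : Fin 3 → ℝ} (hn₁ : n₁ ∈ S)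
    (hfar : ∀ s ∈ S, s ≠ n₁ → n₁ ⬝ᵥ s < n₁ ⬝ᵥ n₁) {μ : ℝ} (hBV₁ : IsBV μ n₁ (u n₁ t))
    {v : Fin 3 → ℝ} (hv : v ∈ S) (hvexp : ∃ φ : Fin 3 → ℝ, ∀ s ∈ S, s ≠ v → φ ⬝ᵥ s < φ ⬝ᵥ v) :
    IsBV μ v (u v t) := by
  classical
  by_contra hvBV
  -- an exposing functional for each exposed point
  let Φ : (Fin 3 → ℝ) → (Fin 3 → ℝ) := fun x =>
    if h : ∃ φ : Fin 3 → ℝ, ∀ s ∈ S, s ≠ x → φ ⬝ᵥ s < φ ⬝ᵥ x then Classical.choose h else 0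
  have hΦ : ∀ x, (∃ φ : Fin 3 → ℝ, ∀ s ∈ S, s ≠ x → φ ⬝ᵥ s < φ ⬝ᵥ x) →
      ∀ s ∈ S, s ≠ x → Φ x ⬝ᵥ s < Φ x ⬝ᵥ x := by
    intro x hx
    simp only [Φ, dif_pos hx]
    exact Classical.choose_spec hx
  -- the non-Beltrami exposed vertices
  set N := S.filter fun x =>
    (∃ φ : Fin 3 → ℝ, ∀ s ∈ S, s ≠ x → φ ⬝ᵥ s < φ ⬝ᵥ x) ∧ ¬ IsBV μ x (u x t) with hN
  have hvN : v ∈ N := Finset.mem_filter.2 ⟨hv, hvexp, hvBV⟩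
  -- the finitely many vectors a generic functional has to avoid
  let tie : (Fin 3 → ℝ) → (Fin 3 → ℝ) → (Fin 3 → ℝ) → (Fin 3 → ℝ) := fun x s s' =>
    (Φ x ⬝ᵥ x - Φ x ⬝ᵥ s) • (s' - x) - (Φ x ⬝ᵥ x - Φ x ⬝ᵥ s') • (s - x)
  let D : Finset (Fin 3 → ℝ) :=
    (((S ×ˢ S).image fun q => q.1 - q.2) ∪
      ((S ×ˢ S ×ˢ S).image fun q => tie q.1 q.2.1 q.2.2)).filter fun d => d ≠ 0
  have hD : ∀ d ∈ D, d ≠ 0 := fun d hd => (Finset.mem_filter.1 hd).2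
  obtain ⟨w, hw⟩ := exists_forall_dot_ne_zero D hD
  -- a generic functional `g = n₁ + ε w` maximised at `n₁`
  obtain ⟨ε₀, hε₀, hpert⟩ := exists_strict_max_perturb (S := S) (ψ := n₁) (g := w) (x := n₁)
    (fun s hs => by
      by_cases h : s = n₁
      · rw [h]
      · exact (hfar s hs h).le)
    (fun s hs heq hne => absurd heq (hfar s hs hne).ne)
  let bad : Finset ℝ := D.image fun d => -(n₁ ⬝ᵥ d) / (w ⬝ᵥ d)
  obtain ⟨ε, ⟨hε0, hεε₀⟩, hεbad⟩ :=
    (Set.Ioo_infinite hε₀).exists_notMem_finset bad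
  set g : Fin 3 → ℝ := n₁ + ε • w with hgdef
  have hgtop : ∀ s ∈ S, s ≠ n₁ → g ⬝ᵥ s < g ⬝ᵥ n₁ := hpert ε hε0 hεε₀.le
  have hgD : ∀ d ∈ D, g ⬝ᵥ d ≠ 0 := by
    intro d hd h0
    apply hεbad
    refine Finset.mem_image.2 ⟨d, hd, ?_⟩
    have hwd := hw d hd
    simp only [hgdef, add_dotProduct, smul_dotProduct, smul_eq_mul] at h0
    field_simp
    linarith
  have hg_ne : ∀ d, d ≠ 0 → (d ∈ ((S ×ˢ S).image fun q => q.1 - q.2) ∨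
      d ∈ ((S ×ˢ S ×ˢ S).image fun q => tie q.1 q.2.1 q.2.2)) → g ⬝ᵥ d ≠ 0 := by
    intro d hd0 hmem
    exact hgD d (Finset.mem_filter.2 ⟨Finset.mem_union.2 hmem, hd0⟩)
  have hginj : ∀ s ∈ S, ∀ s' ∈ S, g ⬝ᵥ s = g ⬝ᵥ s' → s = s' := by
    intro s hs s' hs' heq
    by_contra hne
    refine hg_ne (s - s') (sub_ne_zero.2 hne)
      (Or.inl (Finset.mem_image.2 ⟨(s, s'), Finset.mem_product.2 ⟨hs, hs'⟩, rfl⟩)) ?_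
    rw [dotProduct_sub, heq, sub_self]
  -- the non-Beltrami exposed vertex `x` with the largest value of `g`
  obtain ⟨x, hxN, hxmax⟩ := N.exists_max_image (fun y => g ⬝ᵥ y) ⟨v, hvN⟩
  obtain ⟨hxS, hxexp, hxBV⟩ := Finset.mem_filter.1 hxN
  have hxn₁ : x ≠ n₁ := by rintro rfl; exact hxBV hBV₁
  have hxexp' := hΦ x hxexp
  -- the edge at `x` leaving upwards in `g`
  obtain ⟨lam, hlam, w₁, hw₁S, hgw₁, hψw₁, hψle, hψeq⟩ :=
    exists_exposed_edge_up hxS hxexp' ⟨n₁, hn₁, hgtop x hxS hxn₁⟩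
  set ψ : Fin 3 → ℝ := Φ x + lam • g with hψdef
  have hw₁x : w₁ ≠ x := by rintro rfl; exact lt_irrefl _ hgw₁
  set e : Fin 3 → ℝ := w₁ - x with hedef
  have he0 : e ≠ 0 := sub_ne_zero.2 hw₁x
  have hψe : ψ ⬝ᵥ e = 0 := by rw [hedef, dotProduct_sub, hψw₁, sub_self]
  have hψray : ∀ θ : ℝ, ψ ⬝ᵥ (x + θ • e) = ψ ⬝ᵥ x := fun θ => by
    rw [dotProduct_add, dotProduct_smul, hψe, smul_zero, add_zero]
  have hgray : ∀ θ : ℝ, g ⬝ᵥ (x + θ • e) = g ⬝ᵥ x + θ * (g ⬝ᵥ e) := fun θ => by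
    rw [dotProduct_add, dotProduct_smul, smul_eq_mul]
  have hge : 0 < g ⬝ᵥ e := by rw [hedef, dotProduct_sub]; linarith
  have hcx : ∀ s ∈ S, s ≠ x → 0 < Φ x ⬝ᵥ x - Φ x ⬝ᵥ s := fun s hs hsx => sub_pos.2 (hxexp' s hs hsx)
  let θf : (Fin 3 → ℝ) → ℝ := fun s => (Φ x ⬝ᵥ x - Φ x ⬝ᵥ s) / (Φ x ⬝ᵥ x - Φ x ⬝ᵥ w₁)
  have hray : ∀ s ∈ S, ψ ⬝ᵥ s = ψ ⬝ᵥ x → s ≠ x → 0 < θf s ∧ s = x + θf s • e := by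
    intro s hs hψs hsx
    refine ⟨div_pos (hcx s hs hsx) (hcx w₁ hw₁S hw₁x), ?_⟩
    have h0 : g ⬝ᵥ tie x w₁ s = 0 := tie_vector_eq_zero hψw₁ hψs
    have hz : tie x w₁ s = 0 := by
      by_contra hne
      refine hg_ne _ hne (Or.inr (Finset.mem_image.2 ⟨(x, w₁, s), ?_, rfl⟩)) h0
      simp [hxS, hw₁S, hs]
    have heq : (Φ x ⬝ᵥ x - Φ x ⬝ᵥ w₁) • (s - x) = (Φ x ⬝ᵥ x - Φ x ⬝ᵥ s) • e := sub_eq_zero.1 hz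
    have hc : Φ x ⬝ᵥ x - Φ x ⬝ᵥ w₁ ≠ 0 := (hcx w₁ hw₁S hw₁x).ne'
    have : s - x = θf s • e := by
      rw [show θf s = (Φ x ⬝ᵥ x - Φ x ⬝ᵥ s) / (Φ x ⬝ᵥ x - Φ x ⬝ᵥ w₁) from rfl, div_eq_inv_mul,
        mul_smul, ← heq, smul_smul, inv_mul_cancel₀ hc, one_smul]
    rw [← this]; abel
  have hray' : ∀ s ∈ S, ψ ⬝ᵥ s = ψ ⬝ᵥ x → ∃ θ : ℝ, 0 ≤ θ ∧ s = x + θ • e := by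
    intro s hs hψs
    by_cases hsx : s = x
    · exact ⟨0, le_rfl, by rw [hsx, zero_smul, add_zero]⟩
    · obtain ⟨hpos, heq⟩ := hray s hs hψs hsx
      exact ⟨θf s, hpos.le, heq⟩
  have hparam_unique : ∀ θ θ' : ℝ, x + θ • e = x + θ' • e → θ = θ' := by
    intro θ θ' h
    have h' : (θ - θ') • e = 0 := by rw [sub_smul, sub_eq_zero]; exact add_left_cancel h
    exact sub_eq_zero.1 ((smul_eq_zero.1 h').resolve_right he0)
  -- `ψ x > 0`
  have hM : 0 < ψ ⬝ᵥ x := by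
    have hnegx : -x ∈ S := hS.neg_mem x hxS
    have hle := hψle (-x) hnegx
    rw [dotProduct_neg] at hle
    rcases (show 0 ≤ ψ ⬝ᵥ x by linarith).lt_or_eq with hpos | hzero
    · exact hpos
    · exfalso
      have hall : ∀ s ∈ S, ψ ⬝ᵥ s = ψ ⬝ᵥ x := by
        intro s hs
        have h1 := hψle s hs
        have h2 := hψle (-s) (hS.neg_mem s hs)
        rw [dotProduct_neg] at h2
        linarith
      have hxnn : x ≠ -n₁ := by
        intro hx; apply hxBV; rw [hx, hS.conj]; exact hBV₁.star_neg
      have hgn : g ⬝ᵥ x < g ⬝ᵥ (-n₁) := by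
        rcases hψeq (-n₁) (hS.neg_mem n₁ hn₁) (hall _ (hS.neg_mem n₁ hn₁)) with h' | h'
        · exact absurd h'.symm hxnn
        · exact h'
      have hneq : -x ≠ n₁ := fun h' => hxnn (by rw [← h', neg_neg])
      have := hgtop (-x) hnegx hneq
      rw [dotProduct_neg] at this
      rw [dotProduct_neg] at hgn
      linarith
  -- the set of positive parameters
  set T := S.filter fun s => ψ ⬝ᵥ s = ψ ⬝ᵥ x ∧ s ≠ x with hT
  have hw₁T : w₁ ∈ T := Finset.mem_filter.2 ⟨hw₁S, hψw₁, hw₁x⟩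
  set P := T.image θf with hP
  have hPne : P.Nonempty := ⟨θf w₁, Finset.mem_image_of_mem _ hw₁T⟩
  have hPpos : ∀ θ ∈ P, 0 < θ := by
    intro θ hθ
    obtain ⟨s, hs, rfl⟩ := Finset.mem_image.1 hθ
    obtain ⟨hsS, hψs, hsx⟩ := Finset.mem_filter.1 hs
    exact (hray s hsS hψs hsx).1
  have hPmem : ∀ θ ∈ P, x + θ • e ∈ S := by
    intro θ hθ
    obtain ⟨s, hs, rfl⟩ := Finset.mem_image.1 hθ
    obtain ⟨hsS, hψs, hsx⟩ := Finset.mem_filter.1 hs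
    rw [← (hray s hsS hψs hsx).2]; exact hsS
  have hparam : ∀ θ : ℝ, 0 < θ → x + θ • e ∈ S → θ ∈ P := by
    intro θ hθ hmem
    have hsx : x + θ • e ≠ x := by
      intro h
      have : θ • e = 0 := by
        have h' : x + θ • e = x + 0 := by rw [h, add_zero]
        exact add_left_cancel h'
      exact smul_ne_zero hθ.ne' he0 this
    have hsT : x + θ • e ∈ T := Finset.mem_filter.2 ⟨hmem, hψray θ, hsx⟩
    have heq := (hray _ hmem (hψray θ) hsx).2
    rw [hparam_unique θ _ heq]
    exact Finset.mem_image_of_mem _ hsT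
  have hparam0 : ∀ θ : ℝ, x + θ • e ∈ S → 0 ≤ θ := by
    intro θ hmem
    obtain ⟨θ', hθ', heq⟩ := hray' _ hmem (hψray θ)
    rw [hparam_unique θ θ' heq]; exact hθ'
  -- the far point of the edge: an exposed vertex with larger `g`, hence Beltrami
  set θM := P.max' hPne with hθM
  have hθMP : θM ∈ P := P.max'_mem hPne
  have hθMpos : 0 < θM := hPpos _ hθMP
  set pM := x + θM • e with hpM
  have hpMS : pM ∈ S := hPmem _ hθMP
  have hψpM : ψ ⬝ᵥ pM = ψ ⬝ᵥ x := hψray θM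
  have hψle' : ∀ s ∈ S, ψ ⬝ᵥ s ≤ ψ ⬝ᵥ pM := fun s hs => by rw [hψpM]; exact hψle s hs
  have hpM_top : ∀ s ∈ S, ψ ⬝ᵥ s = ψ ⬝ᵥ pM → s ≠ pM → g ⬝ᵥ s < g ⬝ᵥ pM := by
    intro s hs hψs hspM
    rw [hψpM] at hψs
    obtain ⟨θ, hθ0, rfl⟩ := hray' s hs hψs
    have hθlt : θ < θM := by
      rcases hθ0.lt_or_eq with hpos | hzero
      · exact lt_of_le_of_ne (P.le_max' θ (hparam θ hpos hs)) (fun h => hspM (by rw [h]))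
      · rw [← hzero]; exact hθMpos
    rw [hpM, hgray, hgray]
    nlinarith
  have hpMexp : ∃ φ : Fin 3 → ℝ, ∀ s ∈ S, s ≠ pM → φ ⬝ᵥ s < φ ⬝ᵥ pM := by
    obtain ⟨ε₁, hε₁, h⟩ := exists_strict_max_perturb hψle' hpM_top
    exact ⟨ψ + ε₁ • g, h ε₁ hε₁ le_rfl⟩
  have hgpM : g ⬝ᵥ x < g ⬝ᵥ pM := by rw [hpM, hgray]; nlinarith
  have hpMBV : IsBV μ pM (u pM t) := by
    by_contra hnot
    have hpMN : pM ∈ N := Finset.mem_filter.2 ⟨hpMS, hpMexp, hnot⟩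
    exact absurd (hxmax pM hpMN) (not_le.2 hgpM)
  have hx0 : x ≠ 0 := fun h => hS.zero_notMem (h ▸ hxS)
  have hxe : x ⨯₃ e ≠ 0 := by
    intro h0
    have hdep : ¬ LinearIndependent ℝ ![x, e] := fun hli =>
      (crossProduct_ne_zero_iff_linearIndependent.2 hli) h0
    rw [LinearIndependent.pair_iff' hx0] at hdep
    simp only [not_forall, not_not] at hdep
    obtain ⟨c, hc⟩ := hdep
    have : c * (ψ ⬝ᵥ x) = 0 := by
      have h := hψe
      rwa [← hc, dotProduct_smul, smul_eq_mul] at h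
    rcases mul_eq_zero.1 this with hc0 | hψ0
    · apply he0; rw [← hc, hc0, zero_smul]
    · exact absurd hψ0 hM.ne'
  -- reparametrise from the far end: `pM + θ' (-e) = x + (θM - θ') e`
  have hflip : ∀ θ' : ℝ, pM + θ' • (-e) = x + (θM - θ') • e := fun θ' => by
    rw [hpM, sub_smul, smul_neg]; abel
  have hray'' : ∀ s ∈ S, ψ ⬝ᵥ s = ψ ⬝ᵥ pM → ∃ θ' : ℝ, 0 ≤ θ' ∧ s = pM + θ' • (-e) := by
    intro s hs hψs
    rw [hψpM] at hψs
    obtain ⟨θ, hθ0, rfl⟩ := hray' s hs hψs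
    refine ⟨θM - θ, ?_, by rw [hflip, sub_sub_cancel]⟩
    rcases hθ0.lt_or_eq with hpos | hz
    · linarith [P.le_max' θ (hparam θ hpos hs)]
    · rw [← hz]; linarith
  have hMpM : 0 < ψ ⬝ᵥ pM := by rw [hψpM]; exact hM
  have hψe' : ψ ⬝ᵥ (-e) = 0 := by rw [dotProduct_neg, hψe, neg_zero]
  have he0' : -e ≠ 0 := neg_ne_zero.2 he0
  have hkpM : pM ⨯₃ (-e) ≠ 0 := by
    rw [hpM, LinearMap.map_neg, neg_ne_zero, LinearMap.map_add₂, LinearMap.map_smul₂, cross_self,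
      smul_zero, add_zero]
    exact hxe
  by_cases hsingle : P = {θM}
  · -- a single further point on the edge: `(x, pM)` is simply interacting and `pM` is Beltrami
    have hfirst : ∀ θ : ℝ, 0 < θ → x + θ • e ∈ S → θM ≤ θ := by
      intro θ hθ hmem
      have := hparam θ hθ hmem
      rw [hsingle, Finset.mem_singleton] at this
      rw [this]
    obtain ⟨hsum, huniq⟩ := sip_endpoint_next (S := S) hM hψle hray' hψe he0 hfirst
    have hxpM : x ≠ pM := by
      intro h
      apply smul_ne_zero hθMpos.ne' he0
      have h' : x + θM • e = x + 0 := by rw [← hpM, ← h, add_zero]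
      exact add_left_cancel h'
    have hNI := hS.nonInteracting_of_sip hxS hpMS hxpM hsum huniq ht
    have hk : pM ⨯₃ x ≠ 0 := by
      rw [hpM, LinearMap.map_add₂, LinearMap.map_smul₂, cross_self, zero_add, ← cross_anticomm x e,
        smul_neg, neg_ne_zero]
      exact smul_ne_zero hθMpos.ne' hxe
    exact hxBV (hpMBV.transport hk (hgen x hxS) (hS.div_free x hxS t ht)
      ((nonInteracting_comm pM x (u pM t) (u x t)).1 hNI))
  · -- at least two further points: the far point has two collinear simply interacting partners
    have hQne : (P.erase θM).Nonempty := by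
      by_contra hQ
      apply hsingle
      rw [Finset.not_nonempty_iff_eq_empty] at hQ
      ext θ
      simp only [Finset.mem_singleton]
      constructor
      · intro hθ
        by_contra hne
        have : θ ∈ P.erase θM := Finset.mem_erase.2 ⟨hne, hθ⟩
        rw [hQ] at this; exact absurd this (Finset.notMem_empty _)
      · rintro rfl; exact hθMP
    set θb := (P.erase θM).max' hQne with hθb
    have hθbmem : θb ∈ P.erase θM := (P.erase θM).max'_mem hQne
    have hθbP : θb ∈ P := (Finset.mem_erase.1 hθbmem).2
    have hθbne : θb ≠ θM := (Finset.mem_erase.1 hθbmem).1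
    have hθblt : θb < θM := lt_of_le_of_ne (P.le_max' θb hθbP) hθbne
    have hθbpos : 0 < θb := hPpos θb hθbP
    -- first partner of `pM`
    have hfirst' : ∀ θ' : ℝ, 0 < θ' → pM + θ' • (-e) ∈ S → θM - θb ≤ θ' := by
      intro θ' hθ' hmem
      rw [hflip] at hmem
      have h0 := hparam0 _ hmem
      rcases h0.lt_or_eq with hpos | hzero
      · have hP' : θM - θ' ∈ P := hparam _ hpos hmem
        have hmem' : θM - θ' ∈ P.erase θM := Finset.mem_erase.2 ⟨by linarith, hP'⟩
        have := (P.erase θM).le_max' _ hmem'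
        linarith
      · linarith
    obtain ⟨hsum₂, huniq₂⟩ :=
      sip_endpoint_next (S := S) (θ₂ := θM - θb) hMpM hψle' hray'' hψe' he0' hfirst'
    -- second partner of `pM`: the next parameter below `θb`, or `x` itself
    let θc : ℝ := if h : ((P.erase θM).erase θb).Nonempty then ((P.erase θM).erase θb).max' h else 0
    have hθc0 : 0 ≤ θc := by
      simp only [θc]
      split_ifs with h
      · exact (hPpos _ ((Finset.mem_erase.1 ((Finset.mem_erase.1
          (((P.erase θM).erase θb).max'_mem h)).2)).2)).le
      · exact le_rfl
    have hθclt : θc < θb := by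
      simp only [θc]
      split_ifs with h
      · have hm := ((P.erase θM).erase θb).max'_mem h
        obtain ⟨hne, hmem⟩ := Finset.mem_erase.1 hm
        exact lt_of_le_of_ne ((P.erase θM).le_max' _ hmem) hne
      · exact hθbpos
    have hθcmem : x + θc • e ∈ S := by
      simp only [θc]
      split_ifs with h
      · exact hPmem _ (Finset.mem_erase.1 (Finset.mem_erase.1
          (((P.erase θM).erase θb).max'_mem h)).2).2
      · rw [zero_smul, add_zero]; exact hxS
    have hsecond : ∀ θ' : ℝ, 0 < θ' → θ' ≠ θM - θb → pM + θ' • (-e) ∈ S → θM - θc ≤ θ' := by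
      intro θ' hθ' hne hmem
      rw [hflip] at hmem
      have h0 := hparam0 _ hmem
      rcases h0.lt_or_eq with hpos | hzero
      · have hP' : θM - θ' ∈ P := hparam _ hpos hmem
        have hm1 : θM - θ' ∈ P.erase θM := Finset.mem_erase.2 ⟨by linarith, hP'⟩
        have hm2 : θM - θ' ∈ (P.erase θM).erase θb :=
          Finset.mem_erase.2 ⟨fun h => hne (by linarith), hm1⟩
        have hne' : ((P.erase θM).erase θb).Nonempty := ⟨_, hm2⟩
        have : θM - θ' ≤ θc := by
          simp only [θc, dif_pos hne']
          exact ((P.erase θM).erase θb).le_max' _ hm2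
        linarith
      · linarith
    obtain ⟨hsum₃, huniq₃⟩ :=
      sip_endpoint_second (S := S) (θ₂ := θM - θb) (θ₃ := θM - θc) hMpM hψle' hray'' hψe' he0' hsecond
    -- the two partners as points of `S`
    have hb_mem : pM + (θM - θb) • (-e) ∈ S := by rw [hflip, sub_sub_cancel]; exact hPmem θb hθbP
    have hc_mem : pM + (θM - θc) • (-e) ∈ S := by rw [hflip, sub_sub_cancel]; exact hθcmem
    have hb_ne : pM ≠ pM + (θM - θb) • (-e) := by
      intro h
      have h' : pM + 0 = pM + (θM - θb) • (-e) := by rw [add_zero]; exact h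
      have := add_left_cancel h'
      exact smul_ne_zero (by linarith : θM - θb ≠ 0) he0' this.symm
    have hc_ne : pM ≠ pM + (θM - θc) • (-e) := by
      intro h
      have h' : pM + 0 = pM + (θM - θc) • (-e) := by rw [add_zero]; exact h
      have := add_left_cancel h'
      exact smul_ne_zero (by linarith : θM - θc ≠ 0) he0' this.symm
    have hNI₂ := hS.nonInteracting_of_sip hpMS hb_mem hb_ne hsum₂ huniq₂ ht
    have hNI₃ := hS.nonInteracting_of_sip hpMS hc_mem hc_ne hsum₃ huniq₃ ht
    exact hpMBV.false_of_two_on_ray hkpM (by linarith) (by linarith) (by linarith)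
      (hgen _ hb_mem) (hgen _ hc_mem) (hS.div_free _ hb_mem t ht) (hS.div_free _ hc_mem t ht)
      hNI₂ hNI₃

end KY.IsFiniteModeEulerSolution

end Literature.Analysis.FluidPDE
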